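import Summits.SmoothPoincare4.SmoothPoincare4.Theorems.SblfDescentRungOneHelperBottHessianB
import Summits.SmoothPoincare4.SmoothPoincare4.Theorems.SblfDescentRungOneHelperBottGramSchmidt
import Summits.SmoothPoincare4.SmoothPoincare4.Theorems.SblfDescentRungOneHelperFoldNFTubeIFT
import Literature.Topology.FourManifolds.FibrewiseMorseFrame
import Literature.Topology.FourManifolds.LatticeFormsDefinite
import HarnessLib

/-!
# Fibrewise Morse coordinates along a Morse–Bott maximum circle (tube layer, part C)

Auxiliary file of helper `helper_bott_tube` of stub `helper_sliceGluing_bottRecognition` (fibred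
Morse–Bott recognition of the polar tube), line `Sketch`, crux `SblfDescent.RungOne`.

(Crux item stmt-SmoothPoincare4-18531; skeleton `Cruxes/RungOne/Lines/Sketch.lean`.)

In the setting `BottTube.TSetup` (parts A, B: the height family `g` along a straightened tube
about a Bott-nondegenerate maximum circle is `C^∞`, `1`-periodic, critical on the zero section,
with symmetric positive definite fibre Hessians) we produce **equivariant fibrewise Morse
coordinates**: the Gram–Schmidt frame of the fibre Hessians
(`BottGS.exists_frame`) is a `1`-periodic adapted frame for the Euclidean reference form, so the
periodic fibrewise Morse lemma with a global frame
(`Literature.Topology.FourManifolds.Splitting.exists_periodic_fibrewiseMorseCoords_of_frame`,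
Banyaga–Hurtubise 2004, Thm. 2; Hirsch 1976, Ch. 6 §1) gives periodic `z (t, u)` with
`g (t, u) = ‖z (t, u)‖²` near the zero section (the reference form being positive definite, its
negative index of inertia vanishes, `LinearMap.BilinForm.sigNeg_eq_zero_of_posDef`); the map
`Ψ₂ (t, u) = (t, z (t, u))` is an equivariant tube map with invertible differential along the
zero section, inverted by the periodic tube inverse function theorem (`helper_foldNF_tubeIFT`).
Result: `BottTube.TSetup.exists_fibreCoords`.

## References

* A. Banyaga, D. E. Hurtubise, *A proof of the Morse–Bott Lemma*, Expo. Math. 22 (2004), Thm. 2.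
  [BanyagaHurtubise2004]
* M. W. Hirsch, *Differential Topology*, GTM 33 (1976), Ch. 6 §1, Ch. 4 §5. [HirschDT1976]
-/

set_option linter.dupNamespace false

noncomputable section

open scoped Manifold ContDiff Topology RealInnerProductSpace
open Set Function Filter Metric Literature.Topology.FourManifolds

namespace Summit.SmoothPoincare4.SmoothPoincare4.Cruxes.RungOne.Sketch

namespace BottTube

namespace TSetup

variable {X : Type} [TopologicalSpace X] [ChartedSpace (EuclideanSpace ℝ (Fin 4)) X]
  [IsManifold (𝓡 4) ∞ X] (D : TSetup X)

/-! ### The halved fibre Hessian family and its frame -/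

/-- **Half the fibre Hessian** `H(t)(a, c) = ½ ∂∂g (t, 0) ((0, a), (0, c))`. [folklore] -/
def Hh (t : ℝ) : EuclideanSpace ℝ (Fin 3) →L[ℝ] EuclideanSpace ℝ (Fin 3) →L[ℝ] ℝ :=
  (1 / 2 : ℝ) • (fderiv ℝ (fderiv ℝ D.g) (t, 0)).bilinearComp
    (ContinuousLinearMap.inr ℝ ℝ (EuclideanSpace ℝ (Fin 3))) (ContinuousLinearMap.inr ℝ ℝ (EuclideanSpace ℝ (Fin 3)))

/-- Unfolding of `Hh`. [folklore] -/
theorem Hh_apply (t : ℝ) (a c : EuclideanSpace ℝ (Fin 3)) :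
    D.Hh t a c = 1 / 2 * fderiv ℝ (fderiv ℝ D.g) (t, 0) ((0 : ℝ), a) ((0 : ℝ), c) := by
  simp [Hh]

/-- The second derivative of `g` is smooth. [folklore] -/
theorem contDiff_fderiv_fderiv_g : ContDiff ℝ ∞ (fderiv ℝ (fderiv ℝ D.g)) :=
  (D.contDiff_g.fderiv_right (m := ∞) (by norm_cast)).fderiv_right (m := ∞) (by norm_cast)

/-- `Hh` is smooth. [folklore] -/
theorem contDiff_Hh : ContDiff ℝ ∞ D.Hh := by
  refine contDiff_clm_apply_iff.2 fun a => contDiff_clm_apply_iff.2 fun c => ?_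
  have h : ContDiff ℝ ∞ fun t : ℝ => fderiv ℝ (fderiv ℝ D.g) (t, 0) ((0 : ℝ), a) ((0 : ℝ), c) :=
    ((D.contDiff_fderiv_fderiv_g.comp (contDiff_id.prodMk contDiff_const)).clm_apply contDiff_const).clm_apply
      contDiff_const
  simpa only [Hh_apply] using contDiff_const.mul h

/-- `Hh` is symmetric. [folklore] -/
theorem Hh_symm (t : ℝ) (a c : EuclideanSpace ℝ (Fin 3)) : D.Hh t a c = D.Hh t c a := by
  rw [Hh_apply, Hh_apply, D.heightFamily_spec.2.2.2.2.1 t a c]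

/-- `Hh` is positive definite. [folklore] -/
theorem Hh_pos (t : ℝ) (a : EuclideanSpace ℝ (Fin 3)) (ha : a ≠ 0) : 0 < D.Hh t a a := by
  rw [Hh_apply]
  have := D.heightFamily_spec.2.2.2.2.2 t a ha
  linarith

/-- The second derivative of the periodic `g` is periodic. [folklore] -/
theorem fderiv_fderiv_g_add (q : ℝ × EuclideanSpace ℝ (Fin 3)) :
    fderiv ℝ (fderiv ℝ D.g) (q + (1, 0)) = fderiv ℝ (fderiv ℝ D.g) q := by
  have hfun : D.g = fun x => D.g (x + (1, 0)) := by
    funext x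
    obtain ⟨t, y⟩ := x
    simp only [Prod.mk_add_mk, add_zero, D.g_add_one]
  have h1 : ∀ x, fderiv ℝ D.g x = fderiv ℝ D.g (x + (1, 0)) := fun x => by
    conv_lhs => rw [hfun]
    exact fderiv_comp_add_right (1, 0)
  have hf1 : fderiv ℝ D.g = fun x => fderiv ℝ D.g (x + (1, 0)) := funext h1
  have h2 : fderiv ℝ (fderiv ℝ D.g) q = fderiv ℝ (fderiv ℝ D.g) (q + (1, 0)) := by
    conv_lhs => rw [hf1]
    exact fderiv_comp_add_right (1, 0)
  exact h2.symm

/-- `Hh` is `1`-periodic. [folklore] -/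
theorem Hh_add_one (t : ℝ) : D.Hh (t + 1) = D.Hh t := by
  have h : fderiv ℝ (fderiv ℝ D.g) (t + 1, 0) = fderiv ℝ (fderiv ℝ D.g) (t, 0) := by
    have := D.fderiv_fderiv_g_add (t, 0)
    rwa [Prod.mk_add_mk, add_zero] at this
  simp only [Hh, h]

/-! ### Fibrewise Morse coordinates and the second tube map -/

/-- **Equivariant fibrewise Morse coordinates** (see the module docstring): radii
`0 < ρ ≤ ε₁`, `ρ² ≤ s₀` (so that the shrinking `κ` of part A is the identity on `B(0, ρ)`), `ε₂ > 0`,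
and equivariant tube maps `Ψ₂` (defined on `ℝ × B(0, ρ)`, preserving the parameter) and `Φ₂`
(on `ℝ × B(0, ε₂)`, a right inverse of `Ψ₂` with open image and invertible differentials) with
`g q = ‖(Ψ₂ q).2‖²` on `ℝ × B(0, ρ)`. [cite: BanyagaHurtubise2004, Thm. 2]
[cite: HirschDT1976, Ch. 6 §1, Thm. 1.1] -/
theorem exists_fibreCoords : ∃ (ρ ε₂ : ℝ) (Ψ₂ Φ₂ : ℝ × EuclideanSpace ℝ (Fin 3) → ℝ × EuclideanSpace ℝ (Fin 3)),
    0 < ρ ∧ ρ ≤ D.ε₁ ∧ ρ ^ 2 ≤ D.s₀ ∧ 0 < ε₂ ∧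
      ContDiffOn ℝ ∞ Ψ₂ (univ ×ˢ ball 0 ρ) ∧ (∀ q, (Ψ₂ q).1 = q.1) ∧
      (∀ (t : ℝ) (u : EuclideanSpace ℝ (Fin 3)), Ψ₂ (t + 1, u) = Ψ₂ (t, u) + (1, 0)) ∧
      ContDiffOn ℝ ∞ Φ₂ (univ ×ˢ ball 0 ε₂) ∧ (∀ t : ℝ, Φ₂ (t, 0) = (t, 0)) ∧
      (∀ (s : ℝ) (y : EuclideanSpace ℝ (Fin 3)), y ∈ ball (0 : EuclideanSpace ℝ (Fin 3)) ε₂ →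
        Φ₂ (s + 1, y) = Φ₂ (s, y) + (1, 0)) ∧
      (∀ q ∈ univ ×ˢ ball (0 : EuclideanSpace ℝ (Fin 3)) ε₂,
        Φ₂ q ∈ univ ×ˢ ball (0 : EuclideanSpace ℝ (Fin 3)) ρ ∧ Ψ₂ (Φ₂ q) = q) ∧
      (∀ q ∈ univ ×ˢ ball (0 : EuclideanSpace ℝ (Fin 3)) ε₂, (fderiv ℝ Φ₂ q).IsInvertible) ∧
      IsOpen (Φ₂ '' (univ ×ˢ ball (0 : EuclideanSpace ℝ (Fin 3)) ε₂)) ∧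
      ∀ q ∈ univ ×ˢ ball (0 : EuclideanSpace ℝ (Fin 3)) ρ, D.g q = ‖(Ψ₂ q).2‖ ^ 2 := by
  -- the Gram–Schmidt frame of the halved fibre Hessians
  obtain ⟨M, Minv, hM, hMinv, hdep, hMM, hMM', hHM⟩ :=
    BottGS.exists_frame (P := ℝ) D.contDiff_Hh D.Hh_symm D.Hh_pos
  have hMT : ∀ t, M (t + 1) = M t := fun t => (hdep _ _ (D.Hh_add_one t)).1
  have hMinvT : ∀ t, Minv (t + 1) = Minv t := fun t => (hdep _ _ (D.Hh_add_one t)).2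
  -- the Euclidean reference form
  set B₀ : EuclideanSpace ℝ (Fin 3) →L[ℝ] EuclideanSpace ℝ (Fin 3) →L[ℝ] ℝ := innerSL ℝ with hB₀
  have hB₀a : ∀ u v, B₀ u v = ⟪u, v⟫ := fun u v => rfl
  have hB₀symm : ∀ u v, B₀ u v = B₀ v u := fun u v => by rw [hB₀a, hB₀a, real_inner_comm]
  have hB₀nd : ∀ u, (∀ v, B₀ u v = 0) → u = 0 := fun u hu => by
    have h := hu u
    rwa [hB₀a, inner_self_eq_zero] at h
  have hn : Module.finrank ℝ (EuclideanSpace ℝ (Fin 3)) = 3 := finrank_euclideanSpace_fin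
  have hadapt : ∀ (t : ℝ) (a b : EuclideanSpace ℝ (Fin 3)),
      fderiv ℝ (fderiv ℝ D.g) (t, 0) ((0 : ℝ), a) ((0 : ℝ), b) = 2 * B₀ (M t a) (M t b) := fun t a b => by
    have h := hHM t a b
    rw [Hh_apply] at h
    rw [hB₀a, ← h]; ring
  have hg1 : ∀ (t : ℝ) (a : EuclideanSpace ℝ (Fin 3)), fderiv ℝ D.g (t, 0) ((0 : ℝ), a) = 0 :=
    D.heightFamily_spec.2.2.2.1
  obtain ⟨r, z, Λ, hr, hz, hzper, hz0, hzd, -, hgz⟩ :=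
    Splitting.exists_periodic_fibrewiseMorseCoords_of_frame (n := 3) D.contDiff_g one_pos D.g_add_one
      D.g_zero hg1 B₀ hB₀symm hB₀nd hn hM hMinv hMT hMinvT hMM hMM' hadapt
  -- the reference form is positive definite: no negative squares
  have hσ : sigNeg ((B₀.toBilinForm).toQuadraticMap) = 0 := by
    refine LinearMap.BilinForm.sigNeg_eq_zero_of_posDef fun x hx => ?_
    rw [LinearMap.BilinMap.toQuadraticMap_apply, ContinuousLinearMap.toBilinForm_apply, hB₀a,
      real_inner_self_eq_norm_sq]
    exact pow_pos (norm_pos_iff.2 hx) 2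
  have hgz' : ∀ (t : ℝ) (u : EuclideanSpace ℝ (Fin 3)), u ∈ ball (0 : EuclideanSpace ℝ (Fin 3)) r →
      D.g (t, u) = ‖z (t, u)‖ ^ 2 := fun t u hu => by
    rw [hgz t u hu, hσ]
    have h1 : (Finset.univ.filter fun i : Fin 3 => i.val < 0) = ∅ := by
      ext i; simp
    have h2 : (Finset.univ.filter fun i : Fin 3 => 0 ≤ i.val) = Finset.univ := by
      ext i; simp
    rw [h1, h2, Finset.sum_empty, neg_zero, zero_add, EuclideanSpace.norm_sq_eq]
    refine Finset.sum_congr rfl fun i _ => ?_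
    rw [Real.norm_eq_abs, sq_abs]
  -- the second tube map
  set Ψ₂ : ℝ × EuclideanSpace ℝ (Fin 3) → ℝ × EuclideanSpace ℝ (Fin 3) := fun q => (q.1, z q) with hΨ₂
  set ρ : ℝ := min r (min D.ε₁ √(D.s₀)) with hρ
  have hρpos : 0 < ρ := lt_min hr (lt_min D.hε₁ (Real.sqrt_pos.2 D.s₀_pos_and.1))
  have hρr : ρ ≤ r := min_le_left _ _
  have hρε : ρ ≤ D.ε₁ := (min_le_right _ _).trans (min_le_left _ _)
  have hρs : ρ ^ 2 ≤ D.s₀ := by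
    have h : ρ ≤ √(D.s₀) := (min_le_right _ _).trans (min_le_right _ _)
    calc ρ ^ 2 ≤ √(D.s₀) ^ 2 := pow_le_pow_left₀ hρpos.le h 2
      _ = D.s₀ := Real.sq_sqrt D.s₀_pos_and.1.le
  have hΨ₂s : ContDiffOn ℝ ∞ Ψ₂ (univ ×ˢ ball 0 ρ) :=
    contDiffOn_fst.prodMk (hz.mono (prod_mono le_rfl (ball_subset_ball hρr)))
  have hΨ₂0 : ∀ t : ℝ, Ψ₂ (t, 0) = (t, 0) := fun t => by simp [hΨ₂, hz0]
  have hΨ₂per : ∀ (t : ℝ) (u : EuclideanSpace ℝ (Fin 3)), Ψ₂ (t + 1, u) = Ψ₂ (t, u) + (1, 0) := fun t u => by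
    simp [hΨ₂, hzper]
  -- the differential of `Ψ₂` along the zero section
  have hΨ₂d : ∀ t : ℝ, (fderiv ℝ Ψ₂ (t, 0)).IsInvertible := by
    intro t
    have hmem : ((t, (0 : EuclideanSpace ℝ (Fin 3))) : ℝ × EuclideanSpace ℝ (Fin 3)) ∈ univ ×ˢ ball (0 : EuclideanSpace ℝ (Fin 3)) r :=
      mk_mem_prod (mem_univ t) (mem_ball_self hr)
    have hzdiff : DifferentiableAt ℝ z (t, 0) :=
      (hz.contDiffAt ((isOpen_univ.prod isOpen_ball).mem_nhds hmem)).differentiableAt (by simp)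
    set Dz := fderiv ℝ z (t, 0) with hDz
    set A : EuclideanSpace ℝ (Fin 3) →L[ℝ] EuclideanSpace ℝ (Fin 3) :=
      (Λ : EuclideanSpace ℝ (Fin 3) →L[ℝ] EuclideanSpace ℝ (Fin 3)).comp (M t) with hA
    -- vertical part: `Dz (0, ξ) = A ξ`
    have hvert : ∀ ξ, Dz ((0 : ℝ), ξ) = A ξ := fun ξ => by
      have h1 : HasFDerivAt (z ∘ fun u : EuclideanSpace ℝ (Fin 3) => ((t, u) : ℝ × EuclideanSpace ℝ (Fin 3)))
          (Dz.comp ((0 : EuclideanSpace ℝ (Fin 3) →L[ℝ] ℝ).prod (ContinuousLinearMap.id ℝ _))) 0 := by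
        refine HasFDerivAt.comp 0 hzdiff.hasFDerivAt ?_
        exact (hasFDerivAt_const t 0).prodMk (hasFDerivAt_id 0)
      have h2 := (hzd t).unique h1
      have h3 := congrArg (fun L : EuclideanSpace ℝ (Fin 3) →L[ℝ] EuclideanSpace ℝ (Fin 3) => L ξ) h2
      simp only [ContinuousLinearMap.comp_apply, ContinuousLinearMap.prod_apply,
        ContinuousLinearMap.id_apply] at h3
      rw [hA]
      simpa using h3.symm
    -- horizontal part: `Dz (τ, 0) = 0`
    have hhor : ∀ τ : ℝ, Dz (τ, 0) = 0 := fun τ => by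
      have h1 : HasFDerivAt (z ∘ fun s : ℝ => ((s, 0) : ℝ × EuclideanSpace ℝ (Fin 3)))
          (Dz.comp ((ContinuousLinearMap.id ℝ ℝ).prod (0 : ℝ →L[ℝ] EuclideanSpace ℝ (Fin 3)))) t := by
        refine HasFDerivAt.comp t hzdiff.hasFDerivAt ?_
        exact (hasFDerivAt_id t).prodMk (hasFDerivAt_const (0 : EuclideanSpace ℝ (Fin 3)) t)
      have h0 : (z ∘ fun s : ℝ => ((s, 0) : ℝ × EuclideanSpace ℝ (Fin 3))) = fun _ => 0 := funext fun s => hz0 s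
      rw [h0] at h1
      have h2 := (hasFDerivAt_const (0 : EuclideanSpace ℝ (Fin 3)) t).unique h1
      have h3 := congrArg (fun L : ℝ →L[ℝ] EuclideanSpace ℝ (Fin 3) => L τ) h2
      simp only [FunLike.coe_zero, Pi.zero_apply, ContinuousLinearMap.comp_apply, ContinuousLinearMap.prod_apply,
        ContinuousLinearMap.id_apply] at h3
      exact h3.symm
    have hsplit : ∀ v : ℝ × EuclideanSpace ℝ (Fin 3), Dz v = A v.2 := fun v => by
      have : v = ((v.1, (0 : EuclideanSpace ℝ (Fin 3))) : ℝ × EuclideanSpace ℝ (Fin 3)) + ((0 : ℝ), v.2) := by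
        ext <;> simp
      conv_lhs => rw [this]
      rw [map_add, hhor, zero_add, hvert]
    have hΨ : HasFDerivAt Ψ₂ ((ContinuousLinearMap.fst ℝ ℝ (EuclideanSpace ℝ (Fin 3))).prod Dz) (t, 0) :=
      hasFDerivAt_fst.prodMk hzdiff.hasFDerivAt
    rw [hΨ.fderiv]
    set L := (ContinuousLinearMap.fst ℝ ℝ (EuclideanSpace ℝ (Fin 3))).prod Dz with hL
    set Ainv : EuclideanSpace ℝ (Fin 3) →L[ℝ] EuclideanSpace ℝ (Fin 3) :=
      (Minv t).comp (Λ.symm : EuclideanSpace ℝ (Fin 3) →L[ℝ] EuclideanSpace ℝ (Fin 3)) with hAinv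
    set L' : ℝ × EuclideanSpace ℝ (Fin 3) →L[ℝ] ℝ × EuclideanSpace ℝ (Fin 3) :=
      (ContinuousLinearMap.fst ℝ ℝ (EuclideanSpace ℝ (Fin 3))).prod
        (Ainv.comp (ContinuousLinearMap.snd ℝ ℝ (EuclideanSpace ℝ (Fin 3)))) with hL'
    have hAA : ∀ ξ, Ainv (A ξ) = ξ := fun ξ => by simp [hA, hAinv, hMM']
    have hAA' : ∀ η, A (Ainv η) = η := fun η => by simp [hA, hAinv, hMM]
    have h1 : ∀ v, L' (L v) = v := fun v => by
      obtain ⟨τ, ξ⟩ := v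
      simp only [hL, hL', ContinuousLinearMap.prod_apply, ContinuousLinearMap.coe_fst',
        ContinuousLinearMap.comp_apply, ContinuousLinearMap.coe_snd', hsplit (τ, ξ), hAA]
    have h2 : ∀ w, L (L' w) = w := fun w => by
      obtain ⟨σ, η⟩ := w
      simp only [hL, hL', ContinuousLinearMap.prod_apply, ContinuousLinearMap.coe_fst',
        ContinuousLinearMap.comp_apply, ContinuousLinearMap.coe_snd', Prod.mk.injEq, true_and]
      rw [hsplit]; exact hAA' η
    exact ⟨ContinuousLinearEquiv.equivOfInverse L L' h1 h2, rfl⟩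
  -- invert `Ψ₂` on a uniform tube
  obtain ⟨ε₂, Φ₂, hε₂, hΦ₂s, hΦ₂0, hΦ₂per, hΦ₂inv, hΦ₂d, hΦ₂open⟩ :=
    helper_foldNF_tubeIFT (EuclideanSpace ℝ (Fin 3)) Ψ₂ ρ 1 hρpos one_pos hΨ₂s hΨ₂0 hΨ₂per hΨ₂d
  refine ⟨ρ, ε₂, Ψ₂, Φ₂, hρpos, hρε, hρs, hε₂, hΨ₂s, fun q => rfl, hΨ₂per, hΦ₂s, hΦ₂0, hΦ₂per, hΦ₂inv,
    hΦ₂d, hΦ₂open, ?_⟩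
  rintro ⟨t, u⟩ ⟨-, hu⟩
  exact hgz' t u (ball_subset_ball hρr hu)

end TSetup

end BottTube

end Summit.SmoothPoincare4.SmoothPoincare4.Cruxes.RungOne.Sketch

end
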